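import Summits.Ventures.CertifiedManyBodySolver.Statement
import Summits.Ventures.CertifiedManyBodySolver.Certificates.HubbardChain_n1o2_row90
import Summits.Ventures.CertifiedManyBodySolver.Certificates.HubbardChain_n1o2_fmps_upper_a512
import HarnessLib
import HarnessLib.Audit

/-!
# Ventures/CertifiedManyBodySolver — Certificates/HubbardChain_n1o2_two_sided_U1_best.lean

HONEST FRAMING: first certified bounds; not a superconductivity verdict; every number certified or labelled float.

DOPED Hubbard chain (`n = 1/2`, `t = 1`, thermodynamic limit), `U = 1`: `M1DopedEnergyRow 1 1 2 lo hi` pairing the best certified doped LOWER row #90 (m1-4 w6 R16 b4eom ob32p2 annulus, ref-1 R1.14; Certificates/HubbardChain_n1o2_row90.lean) with the best certified doped UPPER row #89 (var-1 open-segment MPS `a = 512`, `N₀ = 256`, ref-2; Certificates/HubbardChain_n1o2_fmps_upper_a512.lean) — the venture's tightest certified doped e₀ bracket at signature time (float context: Bethe-ansatz e(1/2, 1) ≈ -0.8469 lies inside).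
The theorem takes BOTH claim nodes as hypotheses — nothing here asserts a bound unconditionally. Generated by `gen_two_sided_g146.py`
(pub-mbboot-typer g146): endpoints PARSED from the one-sided theorem texts, `lo < hi` re-checked in exact arithmetic before emission.
-/

noncomputable section

namespace Summit.Ventures.CertifiedManyBodySolver.Certificates

open Literature.MathematicalPhysics.QuantumLattice
open Literature.MathematicalPhysics.QuantumLattice.ThermodynamicLimit

/-- TWO-SIDED row `M1DopedEnergyRow 1 1 2 (-32140813836437085592411/37778931862957161709568) (-29058597253/34359738368)` = `(-32140813836437085592411/37778931862957161709568) ≤ e ≤ (-29058597253/34359738368)` (width `190548269903853493083/37778931862957161709568 ≈ 5.0438e-03`), PROVED from the CERTIFIED.md claim nodes of LOWER row #90 (`cert_r90_dop_chainTL_w6_U1_n1o2_R16b4eom_ob32p2`, theorem `m1dop_U1_n1o2_lower_r90_of`) and UPPER row #89 (`cert_r89_hub1d_doped_p1q2_U1_a512_D64`, theorem `m1dop_U1_n1o2_upper_r89_of`); `M1DopedEnergyRow` is the conjunction lower ∧ upper. -/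
theorem m1dop_U1_n1o2_row_r90_r89_of (hlo : cert_r90_dop_chainTL_w6_U1_n1o2_R16b4eom_ob32p2) (hup : cert_r89_hub1d_doped_p1q2_U1_a512_D64) : M1DopedEnergyRow 1 1 2 (-32140813836437085592411/37778931862957161709568) (-29058597253/34359738368) :=
  ⟨m1dop_U1_n1o2_lower_r90_of hlo, m1dop_U1_n1o2_upper_r89_of hup⟩

end Summit.Ventures.CertifiedManyBodySolver.Certificates

end
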